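import Mathlib
import HarnessLib
import HarnessLib.Audit
import Summits.HubbardSuperconductivity.Statement
import Literature.MathematicalPhysics.QuantumLattice.DWaveSource
import Literature.Barriers.HubbardSuperconductivity.PureModelStripeCompetition
import Literature.Probability.LatticeModels.LatticeGraph
import Summits.HubbardSuperconductivity.HubbardSuperconductivity.Theorems.NodalWardXYAssembly
import HarnessLib.Audit.Status.Attr

/-!
Route: NodalWardXY

DORMANT since 2026-08-24T04:14:23Z (reconciler: no traction for 6.5 d (last activity item-evidence-added at 2026-08-17T15:00:07Z); parked, not closed — `ledger route dormant route-HubbardSuperconductivity-NodalWardXY --off` to reactivat) — unstaffed, not closed; items shared with open routes are served there. `ledger route dormant <id> --off` reactivates.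

Route NodalWardXY — realises idea card nodal-ward-irrelevance-package ("gauge invariance makes nodes
harmless").

THESIS X (it suffices to show X ∧ transfer). X := X_vison ∧ X_eng ∧ X_red, with the shared transfer
X_tr:
- X_vison (decl VisonPairCost): in the lattice d_{x²−y²} BdG reference state on (ℤ/Lℤ)² (hopping 1,
chemical potential μ ∈ (−4,4)∖{0}, bond gap Δ₀ > 0 — four Dirac nodes) a PAIR OF Z₂ FLUXES (visons:
the π Aharonov–Bohm flux that Bogoliubov quasiparticles see around an hc/2e vortex once the pair
phase is gauged away) changes the ground-state energy by at most C(μ,Δ₀), uniformly in the side L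
and in the separation R.
- X_eng (decl PerturbedXYOrder; rev 1: restated 1:1 in plane-rotator coordinates): the classical XY
model on (ℤ/Lℤ)³ at coupling J ≥ J₀ — angles θ ∈ [0,2π]^Λ with product Lebesgue measure (Mathlib
`MeasureTheory.volume`, exactly the vocabulary of the sibling engine BalabanIR.BirComplexStableXY),
weight exp(J Σ_{(x,i)} cos(θ_{x+e_i} − θ_x)) — perturbed by ANY complex current–current interaction
W = Σ_{b,b'} K(b,b') j_b j_{b'} (j_{(x,i)} = sin(θ_{x+e_i} − θ_x) = s_x ∧ s_{x+e_i}) with |K(b,b')|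
≤ ε(1+dist)⁻⁴, has non-vanishing partition function and plateau order Re[L⁻⁶ Σ_{x,y} ⟨cos(θ_x −
θ_y)⟩_W] ≥ a > 0 uniformly in L — a positivity-free LRO engine (Balaban class) widened exactly to
the non-local but summable kernels nodal fermions generate. Only RATIOS of integrals enter, and the
uniform measure on S¹ is the normalised push-forward of Lebesgue measure on [0,2π], so this is the
same statement as the rev-0 O(2)-model form; the O(N)-model module (whose misstated,
never-dischargeable fact isSpecification_onSpecification rode in on the import and kept the route
unstaffed) is no longer imported.
- X_red (decl NodalReduction): X_vison → X_eng → ∃ δ ∈ (0,1/2), U₀ > 0 such that for all 0 < U < U₀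
the Koma–Tasaki d-wave order parameter of the 2D Hubbard model is positive at a chemical potential
of density 1−δ (Literature.MathematicalPhysics.QuantumLattice.HasDWaveOrder U μ). Mechanism: after
the exact U(1) rotation c_x ↦ e^{iθ_x/2} c_x (decl GaugeCovariance, support) the pair phase θ enters
the fermionic action ONLY through bond differences and time derivatives (lattice Ward identity /
minimal coupling), so integrating out the NODAL quasiparticles at fixed gap adds to the (2+1)D XY
action of stiffness ρ_s only (a) analytic local terms, (b) a complex two-current kernel decaying
like |X|⁻⁴ (product of two lattice Dirac propagators, decl NodalPropagatorDecay, support), (c)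
multi-current vertices with faster decay, (d) vortex-loop factors bounded by X_vison — i.e. a model
in the class of X_eng, relatively O(|Q|)-irrelevant against ρ_s q² + κω².
- X_tr (decl SsbToTorusLRO; rev 1: restated to the signature of WeakCouplingBCS.WcbcsSsbToTorusLRO =
stmt-HubbardSuperconductivity-2009, so the item is literally SHARED again — one proof or refutation
serves both routes): on a weak-coupling window ∃ U₀ > 0 ∀ U ∈ (0,U₀), ∀ δ ∈ (0,1/2), ∀ μ whose
grand-canonical tracial ground-state density tends to 1−δ: positive Koma–Tasaki order parameter
(HasDWaveOrder U μ) ⇒ Literature.Barriers.HubbardSuperconductivity.HasDWavePairFieldLROAt U δ, i.e.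
EVERY normalised even-L (N_L, S^z = 0)-sector ground-state sequence has d_{x²−y²} pair-field
long-range order along even sides — word for word the body of the summit. (The rev-0 all-L / δ ∈
(0,1) / quantitative-m² form stmt-0157 had been abandoned by WeakCouplingBCS six minutes after this
route opened; three refuter reviews and the retriage asked for this realignment.)

Lean: `VisonPairCost ∧ PerturbedXYOrder ∧ NodalReduction ∧ SsbToTorusLRO` (decls of
Summit.HubbardSuperconductivity.HubbardSuperconductivity.Theses.NodalWardXY over
Literature.MathematicalPhysics.QuantumLattice.{annihilation, creation, orb,
FermionTorus.ofTorusSite, totalNumber, hubbardTorusWith, HasDWaveOrder}, Matrix.groundEnergy,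
Matrix.groundStateFunctional, Literature.Barriers.HubbardSuperconductivity.HasDWavePairFieldLROAt,
Literature.Probability.LatticeModels.{TorusSite, torusGraph} and Mathlib's MeasureTheory.volume /
MeasureTheory.integral on (TorusSite 3 L → ℝ); every decl elaborates, `lean check` rc 0,
2026-08-15).
Assembly = the deciding theorem `closes : VisonPairCost → PerturbedXYOrder → SsbToTorusLRO →
NodalReduction → HubbardSuperconductivity` (glue.lean, eight lines of logic, sorry-free, axioms
propext/Classical.choice/Quot.sound): NodalReduction applied to the two engines gives δ ∈ (0,1/2),
U₀ and, for each U, a density-matched μ with HasDWaveOrder U μ; SsbToTorusLRO gives its window U₁;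
at U := min(U₀,U₁)/2 it yields HasDWavePairFieldLROAt U δ, which is definitionally the body of the
summit, so ⟨U, δ⟩ closes HubbardSuperconductivity. No odd-L padding and no
pairFieldCorr/torusPullback/halfOpenBox bookkeeping are needed any more; the Assembly item (kept by
the gate) is literally the statement of `closes` and is not a research item.

Rationale: WHY THIS LINE. Every weak-coupling line on this summit (WeakCouplingBCS; cards
chiral-window-d-plus-id, complex-stable-balaban-ir-engine, abelian-duality-vortex-peierls) treats
the four Dirac nodes of the B1g state as the obstruction of the infrared ORDER step and flees to a
gapped (d+id) window. The card's point, made a route: the pair phase is a gauge parameter, so nodal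
quasiparticles feel it only through gradients (ParamekantiEtAl2000, BenfattoEtAl2001,
KosztinLeggett1997: ρ_s(q) = ρ_s − c|q|); the induced kernels are non-analytic but one power
IRRELEVANT and |X|⁻⁴-summable in 2+1 dimensions, the rigorous cousin of GiulianiMastropietro2009
(irrelevance at lattice Dirac points) and GiulianiMastropietroPorta2012 (lattice Ward identities for
Dirac fermions minimally coupled to a gauge field — here the "photon" θ is 2+1D with stiff
propagator, one power easier). What is genuinely dangerous is isolated: the π flux that
quasiparticles see around hc/2e vortices (FranzTesanovic2001, VafekEtAl2001, SenthilFisher2000),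
which cannot be expanded in gradients — crux rank 2. Imported areas: constructive fermionic RG
(X_red); classical low-temperature multiscale RG WITHOUT reflection positivity for X_eng — the only
positivity-free precedent is Balaban1995–98 / BalabanOcarroll1999 (exposition arXiv:1108.1335);
GiulianiOtt2025 (arXiv:2302.07299 §1) is reflection-positivity + infrared-bound based and serves
only as the K = 0 calibration of the plateau, while KennedyKing1986 / FrohlichSpencerCMP1982 are
positive-weight engines (correction recorded by the retriage 2026-08-15); finite-size SSB theory
(KomaTasaki1994) for the shared transfer. Physical analogy used WITH dictionary: θ ↦ U(1) gauge
parameter, quasiparticle current ↦ conserved Noether current, vison ↦ Z₂ holonomy of the half-angle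
rotation.

RANKED CRUXES. (2) VisonPairCost — cheapest decisive test of "nodes are harmless" (exact
diagonalisation of a 2L²×2L² BdG matrix refutes it if false; Lieb1994's flux-phase mechanism even
questions the sign). (3) PerturbedXYOrder — the engine, widened from Balaban's real quasi-local
class to complex power-law-summable two-current kernels; Literature-grade theorem independent of
Hubbard; rev 1 states it in plane-rotator coordinates over Mathlib's product Lebesgue measure (same
mathematics, same vocabulary as BalabanIR.BirComplexStableXY, its merge candidate). (4)
SsbToTorusLRO — rev 1: literally the WeakCouplingBCS rank-2 crux stmt-HubbardSuperconductivity-2009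
(even tori, δ < 1/2, weak-coupling window, qualitative): the Koma–Tasaki converse direction, may be
FALSE without sector uniqueness / off density jumps; one proof/refutation serves both routes. (5)
NodalReduction — the programme itself (upstream weak-coupling construction down to the gap scale +
the nodal IR step); ranked last because it is premature until (2),(3) and effective-action
vocabulary land; stated CONDITIONALLY on (2),(3) so the deciding theorem is pure logic. Supports:
NodalPropagatorDecay (the quantitative heart, provable harmonic analysis now; numerics j000991
queued on the item), GaugeCovariance (the Ward/Peierls lemma; a complete rc-0 proof is attached as
evidence on stmt-1270 and only needs landing by a prover).

KILL CRITERIA. K1: VisonPairCost refuted (cost unbounded in R or L) ⇒ the π-flux sector is not a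
bounded perturbation of the XY vortex gas; close unless a log-bounded restatement still feeds an
engine. K2: VisonPairCost proved but NEGATIVE with |C| above the BdG phase-stiffness scale at the
target doping (vison-dressed vortex loops favoured) ⇒ NodalReduction is dead at generic δ; close as
`superseded` by the chiral-window line. K3: PerturbedXYOrder refuted by an explicit admissible
kernel (Z_K = 0 or plateau → 0 at arbitrarily large J; sharpest known probe: the purely imaginary
diagonal kernel K = zδ_{bb'}, whose Z_K = E_J[e^{zW₀}] is entire of exponential type and must have
complex zeros somewhere — the claim is uniform zero-freeness in the ε-disc) ⇒ restate with the
reality/decay constraints the fermionic kernel actually has, or close. K4: a one-loop lattice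
computation exhibiting a relatively MARGINAL induced term (c·q|ω| on the phonon line) in the
gauge-invariantly regularised nodal polarisation ⇒ the card's premise is false; close. K5:
SsbToTorusLRO (stmt-2009) refuted ⇒ shared pivot with WeakCouplingBCS (GS-uniqueness/gap hypothesis
or close).

DELIBERATELY NOT DECOMPOSED. The interior of NodalReduction (multiscale fermionic integration with a
dynamical phase background, Landau damping of the Anderson–Bogoliubov pole, instanton/space-like
vortex-loop factors beyond static visons, Trotter/continuum-time control, ensemble equivalence μ ↔
δ, quantitative U₀); the anisotropic-box / continuum-time version of the engine that NodalReduction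
actually consumes (PerturbedXYOrder as filed is the isotropic milestone; restating X_eng in the
consumed form, or filing the anisotropic engine as the glue of a split of NodalReduction, is tenure
work once effective-action vocabulary lands); the Kohn–Luttinger B1g window (WeakCouplingBCS item
stmt-HubbardSuperconductivity-0158 is used inside NodalReduction, not re-filed). Definition request
filed: bdgBondHamiltonian (lattice BdG Hamiltonian with arbitrary complex bond hoppings/pairings),
which would shorten VisonPairCost/GaugeCovariance and serve the chiral-window and vortex cards.

CHEAPEST FALSIFIER. Exact diagonalisation of the 2L²×2L² BdG matrix of VisonPairCost (free fermions,
sign-problem-free): dE(L,R) = E₀(H(R)) − E₀(H(0)) for L ≤ 48, all R ≤ L/2 and a handful of (μ,Δ₀); a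
max|dE| saturating in L supports rank 2 (record C and the SIGN for K2), a log-growth in L or R is a
suspect-false lead. Two refuter kit jobs doing exactly this are queued on stmt-1266 (j000170,
j000990; results attach to the item automatically).

Novelty: DELTA (after search): (i) VisonPairCost — a uniform-in-(L,R) two-vison (Z₂ flux pair) energy bound
for the LATTICE nodal d-wave BdG Hamiltonian — is not stated in print: FranzTesanovic2001,
VafekEtAl2001, GaneshanKulkarniDurst2011 treat the linearised Dirac–Aharonov–Bohm SCATTERING
problem, SenthilFisher2000 the vison phenomenology, Lieb1994 the flux energetics of FREE hopping (π
flux lowers the energy at half filling — bears on the sign); (ii) PerturbedXYOrder widens the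
RP-free low-temperature engine Balaban1995 / BalabanOcarroll1999 / GiulianiOtt2025 (REAL, LOCAL
actions) to COMPLEX (1+dist)⁻⁴-summable two-current kernels — the hypothesis nodal fermions force,
absent also from KennedyKing1986 / FrohlichSpencerCMP1982 (positive weights) and from the sibling
card complex-stable-balaban-ir-engine (gapped reference, quasi-local remainder); (iii) the reduction
is the rigorous cousin of GiulianiMastropietro2009 (irrelevance at lattice Dirac points) and
GiulianiMastropietroPorta2012 (lattice Ward identities for 2+1D Dirac fermions minimally coupled to
U(1) gauge field — nearest technology, uncited by the card; our "photon" θ is 2+1D with stiff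
propagator, one power easier), applied to the phase-only actions of ParamekantiEtAl2000 /
BenfattoEtAl2001 / KosztinLeggett1997 (ρ_s(q) = ρ_s − c|q|: exactly the relatively-O(|Q|) nodal
correction, physics-level); first route on this summit whose infrared step stays at generic doping
(pure B1g, nodal) instead of the d+id window. Expected gr  [refs: 10.1016/j.aop.2011.10.007, 10.1007/s00220-012-1444-9, doi:10.1016/j.aop.2011.10.007, doi:10.1007/s00220-012-1444-9, FranzTesanovic2001, VafekEtAl2001, GaneshanKulkarniDurst2011, SenthilFisher2000, Lieb1994, Balaban1995, BalabanOcarroll1999, GiulianiOtt2025, KennedyKing1986, FrohlichSpencerCMP1982, GiulianiMastropietro2009, GiulianiMastropietroPorta2012, ParamekantiEtAl2000, BenfattoEtAl2001, Koszt]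

Barriers (technique_class: constructive-RG determinant-bounds low-T-expansion): technique_class: constructive-RG determinant-bounds low-T-expansion
- Literature.Barriers.HubbardSuperconductivity.WeakCouplingCeiling: APPLIES head-on to the UPSTREAM
half of NodalReduction (reaching the gap scale T ~ e^{-a/U} by a convergent expansion; Cooper
logarithm) and is NOT evaded — the bet is shared with WeakCouplingBCS (two-regime scheme,
Koma–Tasaki source as infrared regulator of the Cooper channel); the nodal package itself
(VisonPairCost, NodalPropagatorDecay, the IR half of NodalReduction) works at FIXED gap and expands
in the phase–current coupling, never in U, so it sits below the barrier's scope.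
- Literature.Barriers.HubbardSuperconductivity.PerturbativeInvisibilityOfPairing and
Literature.Barriers.HubbardSuperconductivity.PerturbativeInvisibilityOfPairingNarrow: apply upstream
only (the scale e^{-C/U²} is flat at U = 0⁺); the order step is organised as an effective XY model
at fixed gap, a resummation outside the class IsPerturbativelyVisibleAt0 (scope caveat (b)).
- Literature.Barriers.HubbardSuperconductivity.LROForcesLowLyingStates: respected, not evaded — the
XY zero mode / tower of states is explicit in the phase model, no anomalous average ⟨Δ_d⟩ ≠ 0 in a
sector eigenstate is ever claimed, and SsbToTorusLRO (shared, rank 4) is exactly where the tower is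
paid for.
- Literature.Barriers.HubbardSuperconductivity.PositiveTemperatureNoPairLRO and
Literature.Barriers.HubbardSuperconductivity.HohenbergMerminWagnerPairing: evaded by dimension — T =
0, effect

Novelty grade: new-combination — ROUTE REVIEW grade (refuter 2f46c378, 2026-08-15; concurring 2nd opinion after 9bee0ce5's full review). new-combination = (A) phase-only effective action of the nodal d-wave state with the pair phase as a U(1) gauge parameter entering only through gradients/Peierls factors (ParamekantiEtAl2000, Benf (refuter refuter-rreview-route-HubbardSuperconduc-2f46c378-0, 2026-08-15T12:19:26Z; prior: ParamekantiEtAl2000 (doi:10.1103/PhysRevB.62.6786), BenfattoEtAl2001, Melikyan-Tesanovic PRB 74, 144501 (2006) doi:10.1103/PhysRevB.74.144501, Melikyan-Tesanovic PRB 71, 214511 (2005) (recalled, not re-read), Ioffe-Millis PRB 66, 094513 (2002) doi:10.1103/PhysRevB.66.094513, FranzTesanovic2001, VafekEtAl2001, GiulianiMastropietro2009, GiulianiMastropietroPorta2012, Balaban1995, BalabanOcarroll1999)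

History (route lifecycle, newest last):
- 2026-08-15T16:22:44Z · rev 1: restated PerturbedXYOrder (stmt-HubbardSuperconductivity-1267), SsbToTorusLRO (stmt-HubbardSuperconductivity-0157) — route-repair (rbadge g2, planner): (a) REROUTE — drop import Literature.Probability.LatticeModels.ONModel (its only unproved fact isSpecification_onSpecificatio (planner-rbadge-HubbardSuperconductivity-NodalW-9f6534bb-g2-0)
- 2026-08-24T04:14:23Z · DORMANT — reconciler: no traction for 6.5 d (last activity item-evidence-added at 2026-08-17T15:00:07Z); parked, not closed — `ledger route dormant route-HubbardSupercond (operator:999:385159)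

sub-problem: HubbardSuperconductivity · status: dormant · opened planner-plancard-HubbardSuperconductivity-Hub-846b2cc9-0 2026-08-15T10:54:08Z · rev 1 · ledger route-HubbardSuperconductivity-NodalWardXY
GENERATED by the gate from the ledger (D-0016/17). Provers cite these decls: `theorem foo : Summit.HubbardSuperconductivity.HubbardSuperconductivity.Theses.NodalWardXY.<Decl> := …` in Summits/HubbardSuperconductivity/HubbardSuperconductivity/Theorems/<Name>.lean.
-/

namespace Summit.HubbardSuperconductivity.HubbardSuperconductivity.Theses.NodalWardXY

open scoped BigOperators Topology Manifold Classical MeasureTheory ProbabilityTheory Matrix InnerProductSpace ComplexConjugate ContinuousMap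
open Filter Set Function TopologicalSpace MeasureTheory

attribute [summit_statement] _root_.HubbardSuperconductivity

open Literature.Hubbard

/-- item stmt-HubbardSuperconductivity-1266 · crux · rank 2 · closed · proved by Summit.HubbardSuperconductivity.HubbardSuperconductivity.Theorems.VisonPairCost.visonPairCost_proof (prover) · by planner
why it might fail: A π-flux binds an r^(-1/2) (log-non-normalisable) zero mode per Dirac node; inter-vison hybridisation and the flipped column holonomies between the visons may give log R / log L drifts; gauge-fixed bounds are only O(R) (string length); rigorous flux energetics are one-sided RP bounds at μ=0.
sources: Lieb1994, arXiv:2501.10065, FranzTesanovic2001, VafekEtAl2001, SenthilFisher2000, GaneshanKulkarniDurst2011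
[crux] Lattice d_{x²−y²} BdG reference Hamiltonian on (ℤ/Lℤ)²: H(R) = Σ_{x,i}
s_R(x,i)·[−Σ_σ(c†_{xσ}c_{x+e_i,σ}+h.c.) + Δ₀ g_i (c_{x↑}c_{x+e_i,↓} − c_{x↓}c_{x+e_i,↑} + h.c.)] −
μN, g = (+1,−1), with the Z₂ gauge field s_R = −1 exactly on the R vertical bonds leaving the sites
(a,0), 0 ≤ a < R (else +1): gauge-invariantly, two VISONS (plaquette flux −1) at plaquettes (R−1,0)
and (L−1,0), separation min(R, L−R). CLAIM: for μ ∈ (−4,4)∖{0} (four Dirac nodes, away from van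
Hove) and Δ₀ > 0 there is C(μ,Δ₀) with |E₀(H(R)) − E₀(H(0))| ≤ C for all L ≥ 4, 2R ≤ L
(Matrix.groundEnergy of the quadratic form). This is the static, gauge-invariant core of the card's
item (4) 'vortex-loop determinant bound': the π flux seen by quasiparticles around an hc/2e vortex
after c ↦ e^{iθ/2}c cannot be expanded in gradients; the XY/duality engines need it to cost at most
O(1) per unit vortex-line length. Cheapest test: exact diagonalisation of the 2L²×2L² BdG matrix, L
≤ 64 (kit). Also wanted (tenure): the SIGN and size of the cost vs the BdG phase stiffness, and
space-like (instanton) loop segments. -/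
@[route_item "route-HubbardSuperconductivity-NodalWardXY", crux]
def VisonPairCost : Prop :=
  ∀ μ : ℝ, μ ∈ Set.Ioo (-4 : ℝ) 4 → μ ≠ 0 → ∀ Δ₀ : ℝ, 0 < Δ₀ → ∃ C : ℝ, ∀ (L : ℕ) [NeZero L], 4 ≤ L → ∀ R : ℕ, 2 * R ≤ L → let c : Literature.Probability.LatticeModels.TorusSite 2 L → Fin 2 → Matrix (Finset (Literature.MathematicalPhysics.QuantumLattice.Orb (Literature.MathematicalPhysics.QuantumLattice.FermionTorus 2 L))) (Finset (Literature.MathematicalPhysics.QuantumLattice.Orb (Literature.MathematicalPhysics.QuantumLattice.FermionTorus 2 L))) ℂ := fun y σ => Literature.MathematicalPhysics.QuantumLattice.annihilation (Literature.MathematicalPhysics.QuantumLattice.orb (Literature.MathematicalPhysics.QuantumLattice.FermionTorus.ofTorusSite y) σ); let H : ℕ → Matrix (Finset (Literature.MathematicalPhysics.QuantumLattice.Orb (Literature.MathematicalPhysics.QuantumLattice.FermionTorus 2 L))) (Finset (Literature.MathematicalPhysics.QuantumLattice.Orb (Literature.MathematicalPhysics.QuantumLattice.FermionTorus 2 L)))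 ℂ := fun R' => (∑ x : Literature.Probability.LatticeModels.TorusSite 2 L, ∑ i : Fin 2, (if i = 1 ∧ x 1 = 0 ∧ (x 0).val < R' then (-1 : ℂ) else 1) • ((∑ σ : Fin 2, -((c x σ)ᴴ * c (x + Pi.single i 1) σ + (c (x + Pi.single i 1) σ)ᴴ * c x σ)) + ((Δ₀ * (if i = 0 then (1 : ℝ) else -1) : ℝ) : ℂ) • ((c x 0 * c (x + Pi.single i 1) 1 - c x 1 * c (x + Pi.single i 1) 0) + (c x 0 * c (x + Pi.single i 1) 1 - c x 1 * c (x + Pi.single i 1) 0)ᴴ))) - (μ : ℂ) • Literature.MathematicalPhysics.QuantumLattice.totalNumber; |(H R).groundEnergy - (H 0).groundEnergy| ≤ C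

-- earlier PerturbedXYOrder (stmt-HubbardSuperconductivity-1267, replaced 2026-08-15T16:22:44Z -> stmt-HubbardSuperconductivity-10739): retired by None — ∃ J₀ ε a : ℝ, 0 < ε ∧ 0 < a ∧ ∀ J : ℝ, J₀ ≤ J → ∀ (L : ℕ) [NeZero L], 2 ≤ L → ∀ K : (Literature.Probability.LatticeModels.TorusSite 3 L × Fin 3) → (Literature.Probability.LatticeModels.TorusSite 3 L × Fin 3) → ℂ, (∀ b b', ‖K b b'‖ ≤ ε / (1 + ((Liter
/-- item stmt-HubbardSuperconductivity-10739 · crux · rank 3 · open · by planner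
why it might fail: The complex non-local two-current tilt kills reflection positivity (FSS1976, GiulianiOtt2025) and positive weights (KennedyKing1986, FrohlichSpencer1982); only an unwritten extension of Balaban's multiscale RG to complex (1+dist)^-4 kernels remains; Z_K may vanish for admissible K as L grows.
sources: Balaban1995, BalabanOcarroll1999, GiulianiOtt2025, arXiv:1108.1335, FrohlichSimonSpencer1976, KennedyKing1986
[crux] ENGINE (Literature-grade, independent of Hubbard; rev 1 = the rev-0 statement in
plane-rotator coordinates). Classical XY (plane rotator) on the torus (ℤ/Lℤ)³: angles θ : TorusSite
3 L → ℝ integrated over the cube [0,2π]^Λ with product Lebesgue measure (Mathlib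
MeasureTheory.volume — the vocabulary of BalabanIR.BirComplexStableXY), ferromagnetic weight w_J(θ)
= exp(J Σ_{(x,i)} cos(θ_{x+e_i} − θ_x)) (directed bonds b = (x,i), i ∈ Fin 3; for L ≥ 3 each torus
edge once), perturbed by the complex weight e^{W_K}, W_K(θ) = Σ_{b,b'} K(b,b') j_b(θ) j_{b'}(θ),
current j_{(x,i)}(θ) = sin(θ_{x+e_i} − θ_x) (= s_x ∧ s_{x+e_i}), K : bonds² → ℂ with |K(b,b')| ≤
ε(1+dist(x,x'))⁻⁴ (torusGraph distance). CLAIM: ∃ J₀, ε, a > 0: for J ≥ J₀, all L ≥ 2 and all such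
K, Z_K = ∫_cube w_J e^{W_K} dθ ≠ 0 and Re[L⁻⁶ Σ_{x,y} ∫_cube cos(θ_x − θ_y) w_J e^{W_K} dθ / Z_K] ≥
a. Only ratios enter and the uniform measure on S¹ is the normalised push-forward of dθ, so this is
exactly the rev-0 claim (onMeasure form) — the O(N)-model module, whose misstated fact
isSpecification_onSpecification rode in on the import and kept the route unstaffable, is no longer
needed. W_K is O(2)-invariant (the plateau is spontan -/
@[route_item "route-HubbardSuperconductivity-NodalWardXY", crux]
def PerturbedXYOrder : Prop :=
  ∃ J₀ ε a : ℝ, 0 < ε ∧ 0 < a ∧ ∀ J : ℝ, J₀ ≤ J → ∀ (L : ℕ) [NeZero L], 2 ≤ L → ∀ K : (Literature.Probability.LatticeModels.TorusSite 3 L × Fin 3) → (Literature.Probability.LatticeModels.TorusSite 3 L × Fin 3) → ℂ, (∀ b b', ‖K b b'‖ ≤ ε / (1 + ((Literature.Probability.LatticeModels.torusGraph 3 L).dist b.1 b'.1 : ℝ)) ^ 4) → let cube : Set (Literature.Probability.LatticeModels.TorusSite 3 L → ℝ) := Set.pi Set.univ (fun _ => Set.Icc (0:ℝ) (2 * Real.pi));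 let cur : (Literature.Probability.LatticeModels.TorusSite 3 L × Fin 3) → (Literature.Probability.LatticeModels.TorusSite 3 L → ℝ) → ℝ := fun b θ => Real.sin (θ (b.1 + Pi.single b.2 1) - θ b.1); let wJ : (Literature.Probability.LatticeModels.TorusSite 3 L → ℝ) → ℂ := fun θ => ((Real.exp (J * ∑ b : Literature.Probability.LatticeModels.TorusSite 3 L × Fin 3, Real.cos (θ (b.1 + Pi.single b.2 1) - θ b.1)) : ℝ) : ℂ); let W : (Literature.Probability.LatticeModels.TorusSite 3 L → ℝ) → ℂ := fun θ => ∑ b, ∑ b', K b b' * (cur b θ : ℂ) * (cur b' θ : ℂ); let Z : ℂ := MeasureTheory.integral (MeasureTheory.volume.restrict cube) (fun θ => wJ θ * Complex.exp (W θ)); Z ≠ 0 ∧ a ≤ ((∑ x : Literature.Probability.LatticeModels.TorusSite 3 L, ∑ y : Literature.Probability.LatticeModels.TorusSite 3 L, MeasureTheory.integral (MeasureTheory.volume.restrict cube) (fun θ => (Real.cos (θ x - θ y) : ℂ) * (wJ θ * Complex.exp (W θ)))) / Z / ((L : ℂ) ^ 6)).re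

-- earlier SsbToTorusLRO (stmt-HubbardSuperconductivity-0157, replaced 2026-08-15T16:22:44Z -> stmt-HubbardSuperconductivity-2009): retired by None — ∀ (U δ μ : ℝ), δ ∈ Set.Ioo (0:ℝ) 1 → Filter.Tendsto (fun L : ℕ => ((Literature.MathematicalPhysics.QuantumLattice.hubbardTorusWith 2 (L + 1) 1 U μ).groundStateFunctional Literature.MathematicalPhysics.QuantumLattice.totalNumber).re / ((L + 1 : ℕ) : ℝ) ^
/-- item stmt-HubbardSuperconductivity-2009 · crux · rank 4 · open · by planner
why it might fail: Not a theorem in this direction (KT1994: only LRO⇒SSB; Conj. 10 open): an even-L S^z=0-sector GS sequence may sit in a coexisting non-d-wave phase at an equal-density first-order point (not excluded by density matching) or lose LRO to a tower of states; GC density at such μ may not converge.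
sources: KomaTasaki1994 §0.7 Cor. 9, Remark 2, Conjecture 10 (arXiv:cond-mat/9708132 pp. 11–12), Tasaki1998 p. 16 (after Thm 5.2), Tasaki2019Tower §1, §3 (arXiv:1807.05847), WreszinskiZagrebnov2016 Remark 4.5 (arXiv:1607.03024), RaghuKivelsonScalapino2010 §III Fig. 2 (arXiv:1002.0591 p. 6: d_{x²-y²} for 1>n>0.6, d_xy below — a first-order boundary inside δ∈(0,1/2)), Literature.Barriers.HubbardSuperconductivity.LROForcesLowLyingStates
[crux] SSB ⇒ LRO transfer (rev 2: even tori, δ<1/2, weak-coupling window, QUALITATIVE). ∃U₀>0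
∀U∈(0,U₀) ∀δ∈(0,1/2) ∀μ: IF the grand-canonical tracial ground-state density Re ω₀(N)/(L+1)² of
hubbardTorusWith 2 (L+1) 1 U μ tends to 1-δ (density matching = the canonical↔GC step; vacuous
inside a first-order GC density jump — how the claim survives phase coexistence, e.g. the
d_{x²-y²}/d_xy boundary δ_c(U)≈0.4 of RKS2010 Fig. 2) AND the Koma–Tasaki order parameter m(U,μ) =
liminf_{h→0⁺} liminf_L Re ω_{L,h}(Δ_d)/L² is positive (HasDWaveOrder; source -h(Δ_d+Δ_d†), L→∞
FIRST), THEN HasDWavePairFieldLROAt U δ: every normalised even-L (N_L,S^z=0)-sector GS sequence of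
the source-free canonical model has liminf_k (2k)⁻⁴ Re⟨ψ_{2k},Δ_d†Δ_d ψ_{2k}⟩ > 0. Expected truth
LRO = m² (KT1994: LRO ≤ m² in this normalisation, i.e. LRO⇒SSB; the sharp converse 'm² ≤ liminf' is
in the planner sketch, implies this item; positivity is all the route needs). SSB⇒LRO for
finite-volume GS is NOT a theorem (KT1994 Conj. 10; Tasaki2019Tower). Weak-coupling proofs may use
by-products of crux 4 (finite-volume gap / sector-GS uniqueness). PROVER/REFUTER: spell the type
out; do NOT import the Theses file (see header). -/
@[route_item "route-HubbardSuperconductivity-NodalWardXY", crux]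
def SsbToTorusLRO : Prop :=
  ∃ U₀ : ℝ, 0 < U₀ ∧ ∀ U ∈ Set.Ioo (0:ℝ) U₀, ∀ δ ∈ Set.Ioo (0:ℝ) (1 / 2), ∀ μ : ℝ, Filter.Tendsto (fun L : ℕ => ((Literature.MathematicalPhysics.QuantumLattice.hubbardTorusWith 2 (L + 1) 1 U μ).groundStateFunctional Literature.MathematicalPhysics.QuantumLattice.totalNumber).re / ((L + 1 : ℕ) : ℝ) ^ 2) Filter.atTop (nhds (1 - δ)) → Literature.MathematicalPhysics.QuantumLattice.HasDWaveOrder U μ → Literature.Barriers.HubbardSuperconductivity.HasDWavePairFieldLROAt U δ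

/-- item stmt-HubbardSuperconductivity-1268 · crux · rank 5 · open · by planner
why it might fail: Even granted both engines it contains the open weak-coupling construction of the d-wave BdG state to the gap scale e^(-C/U²) (Cooper log; WeakCouplingCeiling met head-on) and the nodal IR step (massless multi-current vertices, Landau-damped phase mode, space-time vortex loops); d-wave must win at δ.
sources: Literature.Barriers.HubbardSuperconductivity.WeakCouplingCeiling, BenfattoGiulianiMastropietro2006, RaghuKivelsonScalapino2010, GiulianiMastropietroPorta2012, GiulianiMastropietro2009, ParamekantiEtAl2000
[crux] THE MECHANISM, conditional so that the assembly is pure logic: VisonPairCost →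
PerturbedXYOrder → ∃ δ ∈ (0,1/2), U₀ > 0, ∀ U ∈ (0,U₀) ∃ μ with grand-canonical GS density → 1−δ and
HasDWaveOrder U μ. Intended proof = the card: (1) UPSTREAM (shared with
WeakCouplingBCS.WcbcsBcsConstruction stmt-0159 and the certified B1g window stmt-0158; not this
card's claim): multiscale fermionic RG down to the gap scale Δ ~ e^{−C/U²}, source h =
Cooper-channel regulator, producing the lattice d-wave BdG reference state; (2) NODAL IR STEP (this
card): rotate c_x ↦ e^{iθ_x/2}c_x (GaugeCovariance) — θ enters only via Peierls factors
e^{i(θ_x−θ_y)/2} and (i/2)θ̇·n, i.e. gradients; integrating the nodal quasiparticles at fixed |Δ|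
gives ∇θ·Π·∇θ with |Π(X)| ≲ |X|⁻⁴ (NodalPropagatorDecay squared), relatively O(|Q|) against ρ_s q² +
κω² (Π_jj ~ |Q|, Π_00 ~ q²/|Q|), higher currents by fermionic tree/Gram bounds with |X|^{−2n} decay
(GMP-type multiscale), vortex loops = XY energy × vison factors (VisonPairCost); (3) feed
PerturbedXYOrder ⇒ LRO of e^{iθ} uniformly in small h ⇒ m > 0. Tenure split foreseen:
UpstreamGapScale ∧ NodalIRStep → NodalReduction once effective-action vocabulary lands. -/
@[route_item "route-HubbardSuperconductivity-NodalWardXY", crux]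
def NodalReduction : Prop :=
  VisonPairCost → PerturbedXYOrder → ∃ δ ∈ Set.Ioo (0:ℝ) (1/2), ∃ U₀ : ℝ, 0 < U₀ ∧ ∀ U ∈ Set.Ioo (0:ℝ) U₀, ∃ μ : ℝ, Filter.Tendsto (fun L : ℕ => ((Literature.MathematicalPhysics.QuantumLattice.hubbardTorusWith 2 (L + 1) 1 U μ).groundStateFunctional Literature.MathematicalPhysics.QuantumLattice.totalNumber).re / ((L + 1 : ℕ) : ℝ) ^ 2) Filter.atTop (nhds (1 - δ)) ∧ Literature.MathematicalPhysics.QuantumLattice.HasDWaveOrder U μ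

/-- item stmt-HubbardSuperconductivity-1269 · support · rank 9 · closed · proved by Summit.HubbardSuperconductivity.HubbardSuperconductivity.Theorems.nodalPropagatorDecay_proof (prover) · by planner
sources: ParamekantiEtAl2000, KosztinLeggett1997, GiulianiMastropietro2009
[support] Quantitative heart of 'nodes are harmless', provable harmonic analysis now: the three
Nambu components w_j ∈ {1, ξ/E, Δ/E} of the infinite-volume T=0 imaginary-time BdG propagator of the
lattice d-wave state, ξ(p) = −2(cos p₁+cos p₂) − μ, Δ(p) = 2Δ₀(cos p₁ − cos p₂), E = √(ξ²+Δ²),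
satisfy |∫_{[−π,π]²} e^{ip·x} e^{−|τ|E(p)} w_j(p) dp| ≤ C(μ,Δ₀)(1+|x₁|+|x₂|+|τ|)⁻² for all x ∈ ℤ², τ
∈ ℝ (μ ∈ (−4,4)∖{0}, Δ₀ > 0: four strictly conical nodes on the zone diagonals, E smooth elsewhere;
degree-0 homogeneous singularities ⇒ |x|⁻² Fourier decay; e^{−|τ|E} ⇒ joint (2+1)D Dirac decay
|X|⁻²). Consequence used by NodalReduction: every one-loop current/density polarisation kernel is
O(|X|⁻⁴), absolutely summable on ℤ²×ℝ, hence Π̂(Q) − Π̂(0) = O(|Q| log(1/|Q|)) — irrelevant against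
ρ_s q² + κω². Why support, not crux: expected true; informative only through the constants (blow-up
as μ → 0 van Hove / Δ₀ → 0). -/
@[route_item "route-HubbardSuperconductivity-NodalWardXY"]
def NodalPropagatorDecay : Prop :=
  ∀ μ : ℝ, μ ∈ Set.Ioo (-4 : ℝ) 4 → μ ≠ 0 → ∀ Δ₀ : ℝ, 0 < Δ₀ → ∃ C : ℝ, ∀ (x : Fin 2 → ℤ) (τ : ℝ) (j : Fin 3), ‖∫ p in Set.Icc (-Real.pi) Real.pi ×ˢ Set.Icc (-Real.pi) Real.pi, (let ξ : ℝ := -2 * (Real.cos p.1 + Real.cos p.2) - μ; let Δ : ℝ := 2 * Δ₀ * (Real.cos p.1 - Real.cos p.2); let E : ℝ := Real.sqrt (ξ ^ 2 + Δ ^ 2); Complex.exp (Complex.I * (p.1 * (x 0 : ℝ) + p.2 * (x 1 : ℝ) : ℝ)) * (Real.exp (-|τ| * E) : ℂ) * ((![1, ξ / E, Δ / E] j : ℝ) : ℂ))‖ ≤ C / (1 + |(x 0 : ℝ)| + |(x 1 : ℝ)| + |τ|) ^ 2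

/-- item stmt-HubbardSuperconductivity-1270 · support · rank 9 · closed · proved by Summit.HubbardSuperconductivity.HubbardSuperconductivity.Theorems.gaugeCovariance_proof @ 58a7386f0ba0 (prover) · by planner
sources: KomaTasakiPRL1992, GiulianiMastropietroPorta2012
[support] The Ward/Peierls lemma behind 'θ enters only through gradients', provable now by the
entrywise computation of Literature.MathematicalPhysics.QuantumLattice.gaugeMatrix (Koma–Tasaki eq.
(8)) with imaginary angle: for the unitary U_θ = diag(e^{i Σ_{o∈s} θ_{site(o)}}) on the Fock space
of any finite orbital set, U_θ U_{−θ} = 1, U_θ c_{xσ} U_{−θ} = e^{−iθ_x} c_{xσ}, U_θ c†_{xσ} U_{−θ}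
= e^{iθ_x} c†_{xσ}. Hence every charge-conserving bond term transforms by e^{i(θ_x−θ_y)} (Peierls
factor = discrete GRADIENT), n_{xσ} is invariant, and a pair term c_{x↑}c_{y↓} by e^{−i(θ_x+θ_y)} —
so a pair-phase background is removed from the source/gap term and reappears only as bond
differences in the hopping (plus (i/2)θ̇·n from the time derivative): no bare θ·O coupling survives.
Used inside NodalReduction; reusable by the chiral-window / vortex / flux-spectroscopy cards. -/
@[route_item "route-HubbardSuperconductivity-NodalWardXY"]
def GaugeCovariance : Prop :=
  ∀ (Λ : Type) [LinearOrder Λ] [Fintype Λ] (θ : Λ → ℝ) (x : Λ) (σ : Fin 2), let Uθ : ℝ → Matrix (Finset (Literature.MathematicalPhysics.QuantumLattice.Orb Λ)) (Finset (Literature.MathematicalPhysics.QuantumLattice.Orb Λ)) ℂ := fun t => Matrix.diagonal fun s => Complex.exp (Complex.I * (t : ℂ) * ∑ o ∈ s, (θ (ofLex o).1 : ℂ)); Uθ 1 * Uθ (-1) = 1 ∧ Uθ 1 * Literature.MathematicalPhysics.QuantumLattice.annihilation (Literature.MathematicalPhysics.QuantumLattice.orb x σ) * Uθ (-1) = Complex.exp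 (-(Complex.I * (θ x : ℂ))) • Literature.MathematicalPhysics.QuantumLattice.annihilation (Literature.MathematicalPhysics.QuantumLattice.orb x σ) ∧ Uθ 1 * Literature.MathematicalPhysics.QuantumLattice.creation (Literature.MathematicalPhysics.QuantumLattice.orb x σ) * Uθ (-1) = Complex.exp (Complex.I * (θ x : ℂ)) • Literature.MathematicalPhysics.QuantumLattice.creation (Literature.MathematicalPhysics.QuantumLattice.orb x σ)

/-- item stmt-HubbardSuperconductivity-1271 · assembly · rank 1 · closed · proved by Summit.HubbardSuperconductivity.HubbardSuperconductivity.Theorems.nodalWardXY_assembly_proof (prover) · by planner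
sources: Scalapino1995, KomaTasaki1994
[assembly] VisonPairCost → PerturbedXYOrder → SsbToTorusLRO → NodalReduction →
HubbardSuperconductivity. Proof plan (logic + bookkeeping shared with WeakCouplingBCS.Assembly):
apply NodalReduction to the first two hypotheses to get δ ∈ (0,1/2), U₀; take U := U₀/2 and its μ;
given a summit sequence (N, ψ) constrained at even L only, replace ψ at odd L by normalised (N_L,
S^z=0)-sector ground states (the sector is non-empty: N_L = 2⌊(1−δ)L²/2⌋ ≤ 2L², even); SsbToTorusLRO
gives dWaveOrderParameter² ≤ liminf over all L of L⁻⁴ Re expect(Δ_d†Δ_d); since dWaveOrderParameter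
> 0 the liminf along even L = 2k is ≥ m² > 0; finally Re⟨Δ_d†Δ_d⟩_{2k} = Σ_{x,y ∈ (ℤ/2kℤ)²}
pairFieldCorr dWaveFormFactor ψ (2k) x y (expect_pairField_conjTranspose_mul) = the block double sum
of torusPullback (pairFieldCorr …) (2k) over halfOpenBox 2 (2k) (torusPullback/halfOpenBox
bijection), normalisation (2k)⁻⁴ = |halfOpenBox|⁻², which is HasLongRangeOrder as in the Statement
(liminf side conditions: the sequence is bounded by ‖Δ_d‖²/L⁴ ≤ const). -/
@[route_item "route-HubbardSuperconductivity-NodalWardXY"]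
def Assembly : Prop :=
  VisonPairCost → PerturbedXYOrder → SsbToTorusLRO → NodalReduction → HubbardSuperconductivity

/-- `Assembly` holds: proved by `Summit.HubbardSuperconductivity.HubbardSuperconductivity.Theorems.nodalWardXY_assembly_proof`. -/
theorem Assembly_holds : Assembly := _root_.Summit.HubbardSuperconductivity.HubbardSuperconductivity.Theorems.nodalWardXY_assembly_proof

/-! D-0027 §2.1 — DECIDING THEOREM (planner-authored via `route open/edit --closes-file`; by planner-rbadge-HubbardSuperconductivity-NodalW-9f6534bb-g2-0 2026-08-15T16:22:44Z):
its hypotheses are this route's items and its conclusion the sub-problem Statement (glue_lint), and it elaborates with this file. -/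

@[closes "route-HubbardSuperconductivity-NodalWardXY"] theorem closes (h_VisonPairCost : VisonPairCost) (h_PerturbedXYOrder : PerturbedXYOrder)
    (h_SsbToTorusLRO : SsbToTorusLRO) (h_NodalReduction : NodalReduction) :
    _root_.HubbardSuperconductivity := by
  obtain ⟨δ, hδ, U₀, hU₀, hwin⟩ := h_NodalReduction h_VisonPairCost h_PerturbedXYOrder
  obtain ⟨U₁, hU₁, htr⟩ := h_SsbToTorusLRO
  have hm : 0 < min U₀ U₁ := lt_min hU₀ hU₁
  obtain ⟨μ, hdens, hord⟩ := hwin (min U₀ U₁ / 2)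
    ⟨half_pos hm, lt_of_lt_of_le (half_lt_self hm) (min_le_left _ _)⟩
  exact ⟨min U₀ U₁ / 2, half_pos hm, δ, hδ,
    htr (min U₀ U₁ / 2) ⟨half_pos hm, lt_of_lt_of_le (half_lt_self hm) (min_le_right _ _)⟩
      δ hδ μ hdens hord⟩

end Summit.HubbardSuperconductivity.HubbardSuperconductivity.Theses.NodalWardXY
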